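import Literature.MathematicalPhysics.QuantumFieldTheory.Balaban1983to89.Beta.OneBlockTorusKKT

/-!
# One-block torus: Liouville for torus-harmonic 0-cochains and the DESCENT OF THE GAUGE CONDITION

HONEST FRAMING (binding, verbatim): "discharging BetaPertH makes Balaban's UV stability UNCONDITIONAL — a real
constructive-QFT result; it is NOT the continuum limit and NOT the Clay problem."  This module is NOT summit progress.

WHAT THIS FILE IS.  [folklore] finite-dimensional linear algebra on the one-block torus `𝕋 = Fin d → ZMod N` in the setting of
the sibling `Beta.OneBlockTorusKKT` (`C0/C1 = EuclideanSpace ℝ _`, explicit `d0`, codifferential `LinearMap.adjoint d0`, torus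
Laplacian `Δ = δ0 ∘ d0`).  Nothing of Bałaban's manuscripts is asserted.  It supplies the kernel half of the «gauge descent» step
(HOME/BETA/AN2.md §11 (Y15) (B3-loc)(ii)): in infinite volume the gauge condition of the constrained minimiser is the PROJECTED one,
`R δ0 A = 0` with `R` the orthogonal projection onto `Δ(N(Q′))` ([Balaban1985BackgroundPropagators] p. 394 (3.21), CONTEXT locator),
whose restriction to block-periodic fields says only that `Δ (δ0 A)` is constant on the torus; this file proves that on the torus
that already forces the FULL condition `δ0 A = 0` wanted by `OneBlockTorusKKT.oneBlock_uniqueness`: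
* `d0_eq_zero_of_lap_eq_zero` — `δ0 (d0 u) = 0 → d0 u = 0` (energy identity `⟪u, δ0 d0 u⟫ = ‖d0 u‖²`);
* `apply_eq_of_d0_eq_zero` — `d0 u = 0 → u x = u y` (the torus is connected by unit steps: every point is `Σ_κ (z κ).val • e_κ`);
* `total_lap_eq_zero` — the torus Laplacian of anything has total sum zero; hence `lap_eq_zero_of_lap_const`: `Δ u` constant ⟹ `Δ u = 0`;
* `eq_zero_of_d0_eq_zero_of_total` — a constant 0-cochain with total sum zero vanishes;
* **`gauge_descent`** — for any 1-cochain `D`: if `Δ (δ0 D)` is a constant cochain then `δ0 D = 0`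
  (uses `OneBlockTorusKKT.total_adjoint_d0_eq_zero`: `δ0 D` always has total zero);
* **`oneBlock_uniqueness_of_lap_gauge`** — `oneBlock_uniqueness` with the gauge hypothesis weakened to «`Δ (δ0 D)` is constant».
-/

namespace Literature.MathematicalPhysics.QuantumFieldTheory.Balaban1983to89.Beta.OneBlockTorusKKT

open scoped InnerProductSpace

variable {d N : ℕ} [NeZero N]

/-- ENERGY: `δ0 (d0 u) = 0 → d0 u = 0`. [folklore] -/
theorem d0_eq_zero_of_lap_eq_zero (u : C0 d N) (h : LinearMap.adjoint d0 (d0 u) = 0) : d0 u = 0 := by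
  have h1 : ⟪d0 u, d0 u⟫_ℝ = 0 := by
    rw [← LinearMap.adjoint_inner_right, h, inner_zero_right]
  exact inner_self_eq_zero.1 h1

omit [NeZero N] in
/-- Unit steps: `d0 u = 0` gives `u (x + n • e κ) = u x`. [folklore] -/
theorem apply_add_nsmul_e_of_d0_eq_zero (u : C0 d N) (h : d0 u = 0) (κ : Fin d) :
    ∀ (n : ℕ) (x : 𝕋 d N), u (x + n • e κ) = u x := by
  have step : ∀ x : 𝕋 d N, u (x + e κ) = u x := by
    intro x
    have hx := congrArg (fun D : C1 d N => D (κ, x)) h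
    simp only [d0_apply, PiLp.zero_apply] at hx
    linarith
  intro n
  induction n with
  | zero => intro x; simp
  | succ n ih => intro x; rw [succ_nsmul, ← add_assoc, step, ih]

/-- Every torus point is a sum of unit steps: `z = Σ_κ (z κ).val • e_κ`. [folklore] -/
theorem eq_sum_val_smul_e (z : 𝕋 d N) : z = ∑ κ : Fin d, (z κ).val • (e κ : 𝕋 d N) := by
  conv_lhs => rw [← Finset.univ_sum_single z]
  refine Finset.sum_congr rfl fun κ _ => ?_
  rw [e, ← Pi.single_smul', nsmul_eq_mul, mul_one, ZMod.natCast_zmod_val]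

/-- CONNECTEDNESS: `d0 u = 0 → u x = u y`. [folklore] -/
theorem apply_eq_of_d0_eq_zero (u : C0 d N) (h : d0 u = 0) (x y : 𝕋 d N) : u x = u y := by
  suffices key : ∀ z : 𝕋 d N, u z = u 0 by rw [key x, key y]
  intro z
  have aux : ∀ s : Finset (Fin d), u (∑ κ ∈ s, (z κ).val • (e κ : 𝕋 d N)) = u 0 := by
    intro s
    induction s using Finset.induction_on with
    | empty => simp
    | insert a s ha ih =>
      rw [Finset.sum_insert ha, add_comm, apply_add_nsmul_e_of_d0_eq_zero u h a _ _, ih]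
  rw [eq_sum_val_smul_e z]
  exact aux Finset.univ

/-- The torus Laplacian of anything has total sum zero. [folklore] -/
theorem total_lap_eq_zero (u : C0 d N) : ∑ x : 𝕋 d N, (LinearMap.adjoint d0 (d0 u)) x = 0 :=
  total_adjoint_d0_eq_zero (d0 u)

/-- A 0-cochain which is constant (`d0 c = 0`) and has total sum zero vanishes. [folklore] -/
theorem eq_zero_of_d0_eq_zero_of_total (c : C0 d N) (hc : d0 c = 0) (ht : ∑ x : 𝕋 d N, c x = 0) : c = 0 := by
  have hconst : ∀ x, c x = c 0 := fun x => apply_eq_of_d0_eq_zero c hc x 0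
  have hsum : ∑ x : 𝕋 d N, c x = (Fintype.card (𝕋 d N) : ℝ) * c 0 := by
    rw [Finset.sum_congr rfl fun x _ => hconst x, Finset.sum_const, Finset.card_univ, nsmul_eq_mul]
  have hcard : (Fintype.card (𝕋 d N) : ℝ) ≠ 0 := by
    rw [Nat.cast_ne_zero, Fintype.card_pi, Finset.prod_const, ZMod.card]
    exact pow_ne_zero _ (NeZero.ne N)
  have h0 : c 0 = 0 := by
    rw [hsum] at ht
    rcases mul_eq_zero.1 ht with h' | h'
    · exact absurd h' hcard
    · exact h'
  ext x
  rw [hconst x, h0, PiLp.zero_apply]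

/-- `Δ u` constant ⟹ `Δ u = 0`. [folklore] -/
theorem lap_eq_zero_of_lap_const (u : C0 d N) (h : d0 (LinearMap.adjoint d0 (d0 u)) = 0) :
    LinearMap.adjoint d0 (d0 u) = 0 :=
  eq_zero_of_d0_eq_zero_of_total _ h (total_lap_eq_zero u)

/-- **GAUGE DESCENT**: if the torus Laplacian of the codifferential `δ0 D` is a constant cochain, then `δ0 D = 0`
(Δ(δ0 D) constant ⟹ Δ(δ0 D) = 0 ⟹ d0 (δ0 D) = 0 ⟹ δ0 D constant ⟹ δ0 D = 0, its total being zero). [folklore] -/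
theorem gauge_descent (D : C1 d N) (h : d0 (LinearMap.adjoint d0 (d0 (LinearMap.adjoint d0 D))) = 0) :
    LinearMap.adjoint d0 D = 0 := by
  have h1 : LinearMap.adjoint d0 (d0 (LinearMap.adjoint d0 D)) = 0 := lap_eq_zero_of_lap_const _ h
  have h2 : d0 (LinearMap.adjoint d0 D) = 0 := d0_eq_zero_of_lap_eq_zero _ h1
  exact eq_zero_of_d0_eq_zero_of_total _ h2 (total_adjoint_d0_eq_zero D)

/-- **ONE-BLOCK UNIQUENESS WITH THE DESCENDED GAUGE CONDITION**: (Hdg) → stationarity → `Q D = 0` → «`Δ (δ0 D)` constant» → `D = 0`.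
[folklore] -/
theorem oneBlock_uniqueness_of_lap_gauge (hH : Hdg d N) {D : C1 d N} {φ : W d} {ψ : C0 d N}
    (hstat : LinearMap.adjoint d1 (d1 D) = LinearMap.adjoint Q φ + d0 ψ) (hQ : Q D = 0)
    (hg : d0 (LinearMap.adjoint d0 (d0 (LinearMap.adjoint d0 D))) = 0) : D = 0 :=
  oneBlock_uniqueness hH hstat hQ (gauge_descent D hg)

/-- Witness (d = 1, N = 2): the hypothesis of `gauge_descent` is not vacuous — it holds for `D = 0`. [folklore] -/
example : d0 (LinearMap.adjoint d0 (d0 (LinearMap.adjoint d0 (0 : C1 1 2)))) = 0 := by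
  simp only [map_zero]

end Literature.MathematicalPhysics.QuantumFieldTheory.Balaban1983to89.Beta.OneBlockTorusKKT
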